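import Summits.BirchSwinnertonDyer.BirchSwinnertonDyer.Theorems.ManinLocalTwoThreePeriodLatticeFortyEight
import Summits.BirchSwinnertonDyer.BirchSwinnertonDyer.Theorems.ManinLocalTwoThreeEulerRemaindersFortyEight
import Summits.BirchSwinnertonDyer.BirchSwinnertonDyer.Theorems.ManinLocalTwoThreeNeronSqueeze
import Summits.BirchSwinnertonDyer.Rank1Residual.Additive.IntModelConductorCertificate
import HarnessLib

/-!
# Level 48: the Ligozat identities of `X₀(48) → 48a1` and `|c| = 1` on `X₀(48)` — unconditionally (first level of genus `> 1`)

Cell bsd-f2-manin, route `ManinLocalTwoThree` (crux C2 `ManinOddAtFour`, stmt-22967: `2² ∣ 48`), prover seat p2 gen 26.  Sequel to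
`NewformFortyEight`/`NewformPinningFortyEight` (`D.f = φ₄₈` for every `X₀(48)`-datum, fact-free; Sturm at `48`),
`EtaIdentityReductionFortyEight` (the identities from three `q`-limits; the cusp `1/24` via `W = (1 0; 24 1)`) and
`EulerRemaindersFortyEight` (Euler truncations modulo `o(q⁹)`).

* §1 (T1)₄₈ `((2πi)⁻¹x′ + φ₄₈·2y)/q⁶ → 0`, (T2)₄₈ `((2πi)⁻¹y′ + φ₄₈(3x² − 4x − 3))/q⁶ → 0`, (T3)₄₈ `x³ − 2x² − 3x − y² → 0`: the
  numerators over `q^aE_*` are `o(q⁹)` with explicit witnesses (`scripts/trunc48.py`: `G₁ = X¹⁰S₁`, `G₂ = X¹⁰S₂`, `G₃ = X¹⁰S₃`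
  modulo the truncation, `S₁, S₂, S₃` of `12, 37, 39` terms).
* §2 The identities `x′ = −2πiφ₄₈·2y`, `y′ = −2πiφ₄₈(3x² − 4x − 3)`, **`y² = x³ − 2x² − 3x`** (= `48a1` translated by `1`), and
  **(S2)₄₈ `Λ(D.f) ⊆ Λ(52/3, 280/27)`** for every `X₀(48)`-datum.
* §3 THE NÉRON SQUEEZE at `48` (p3's general `NeronSqueeze.abs_maninConstant_eq_one_of_periodLattice_le` with the globally minimal
  `W₀ = [0, −2, 0, −3, 0] ≅ 48a1`, `c₄ = 208`, `c₆ = 2240`, `Δ = 2⁸3²`): **`|c(D)| = 1`, hence `2 ∤ c(D)`, for every lattice-optimal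
  `X₀(48)`-datum `D` of every globally minimal elliptic `W/ℚ`** — C2's conclusion at the genus-`3` level `48`, unconditionally.

* §4 `N([0,−2,0,−3,0]) = 48` by a kernel Tate certificate (`I₀*` at `2` after `(r,s,t) = (1,1,2)`), and — CONDITIONAL on the item's own
  binder `exists_isNewformOf` (no CM at `48`) — the `X₀(48)`-domain of C2 is inhabited.

HONEST FRAMING: §1–§3 fact-free (axioms `propext`, `Classical.choice`, `Quot.sound`); §4's inhabitation is conditional on
`exists_isNewformOf`; nothing here proves C2 for all `N`, Manin's conjecture, or BSD. [cite: Ligozat1975, Ch. 4]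
[cite: CremonaAlgorithms1997, Table 1 (48a1), §2.10] [cite: SilvermanAEC2009, VII.1 Remark 1.1]
-/

set_option autoImplicit false
-- lint-debt: the directory name repeats the summit name (sibling precedent `ManinLocalTwoThreeEtaIdentitiesTwentyFour.lean`)
set_option linter.dupNamespace false

noncomputable section

open Complex Filter Topology Set Asymptotics Polynomial
open UpperHalfPlane hiding I
open scoped Real Topology Manifold MatrixGroups ModularForm
open ModularForm CongruenceSubgroup WeierstrassCurve
open Summit.BirchSwinnertonDyer.BirchSwinnertonDyer.Rank2Observatory
open Summit.BirchSwinnertonDyer.BirchSwinnertonDyer.Rank2Observatory.Tate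
open Literature.NumberTheory.Automorphic
open Summit.BirchSwinnertonDyer.BirchSwinnertonDyer.Rank2Observatory.RootNumber
open Summit.BirchSwinnertonDyer.Rank1Residual.Additive
open Literature.NumberTheory.EllipticCurves Literature.NumberTheory.EllipticCurves.ModularForms

namespace Summit.BirchSwinnertonDyer.BirchSwinnertonDyer.Theorems.ManinLocalTwoThree.EtaIdentitiesFortyEight

open QRemainder EulerRemainders EulerRemaindersFortyEight NewformFortyEight EtaIdentityReductionFortyEight

/-! ## §1 The `q`-asymptotics (T1), (T2), (T3) at `i∞` -/

/-- **(T1)₄₈**: `((2πi)⁻¹x′ + φ₄₈·2y)/q⁶ → 0` at `i∞`. [cite: Ligozat1975, Ch. 4] -/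
theorem tendsto_T1 :
    Tendsto (fun τ : ℍ ↦ ((2 * π * I)⁻¹ * deriv (etaQuotient 48 (expFn [(4, -2), (8, 4), (12, 2), (24, -4)]) ∘ ofComplex) τ
      + etaQuotient 48 (expFn [(2, -1), (4, 4), (6, -1), (8, -1), (12, 4), (24, -1)]) τ * (2 * etaQuotient 48 (expFn [(2, 1), (4, -2), (6, 1), (8, 3), (12, 2), (24, -5)]) τ))
      / Function.Periodic.qParam 1 (τ : ℂ) ^ 6) atImInfty (𝓝 0) := by
  have h2pi : (2 * π * I : ℂ) ≠ 0 := by simp [Real.pi_ne_zero, I_ne_zero]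
  have hE2 := tendsto_eulerFn_two_nine
  have hE4 := tendsto_eulerFn_four_nine
  have hE6 := tendsto_eulerFn_six_nine
  have hE8 := tendsto_eulerFn_eight_nine
  have hE12 := tendsto_eulerFn (δ := 12) (m := 9) (by norm_num)
  have hE24 := tendsto_eulerFn (δ := 24) (m := 9) (by norm_num)
  have hT2 := QRemainder.congr_poly (P' := -2 * X ^ 2 - 4 * X ^ 4)
    (by rw [← mul_assoc, ← map_mul, inv_mul_cancel₀ h2pi, map_one, one_mul])
    (QRemainder.const_mul (2 * π * I)⁻¹ tendsto_deriv_eulerFn_two_nine)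
  have hT4 := QRemainder.congr_poly (P' := -4 * X ^ 4 - 8 * X ^ 8)
    (by rw [← mul_assoc, ← map_mul, inv_mul_cancel₀ h2pi, map_one, one_mul])
    (QRemainder.const_mul (2 * π * I)⁻¹ tendsto_deriv_eulerFn_four_nine)
  have hT6 := QRemainder.congr_poly (P' := -6 * X ^ 6)
    (by rw [← mul_assoc, ← map_mul, inv_mul_cancel₀ h2pi, map_one, one_mul])
    (QRemainder.const_mul (2 * π * I)⁻¹ tendsto_deriv_eulerFn_six_nine)
  have hT8 := QRemainder.congr_poly (P' := -8 * X ^ 8)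
    (by rw [← mul_assoc, ← map_mul, inv_mul_cancel₀ h2pi, map_one, one_mul])
    (QRemainder.const_mul (2 * π * I)⁻¹ tendsto_deriv_eulerFn_eight_nine)
  have hT12 := QRemainder.congr_poly (P' := 0) (by rw [mul_zero])
    (QRemainder.const_mul (2 * π * I)⁻¹ (tendsto_deriv_eulerFn (δ := 12) (m := 9) (by norm_num)))
  have hT24 := QRemainder.congr_poly (P' := 0) (by rw [mul_zero])
    (QRemainder.const_mul (2 * π * I)⁻¹ (tendsto_deriv_eulerFn (δ := 24) (m := 9) (by norm_num)))
  -- `G₁ = E₈³E₁₂E₂₄·(4T₈E₁₂E₄E₂₄ + 2T₁₂E₈E₄E₂₄ − 2E₈E₁₂E₄E₂₄ − 2T₄E₈E₁₂E₂₄ − 4T₂₄E₈E₁₂E₄) + 2E₄⁵E₈²E₁₂⁶ = o(q⁹)`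
  have hinner := QRemainder.sub (QRemainder.sub (QRemainder.sub (QRemainder.add (QRemainder.mul (QRemainder.mul (QRemainder.mul (QRemainder.const_mul 4 (hT8)) (hE12)) (hE4)) (hE24)) (QRemainder.mul (QRemainder.mul (QRemainder.mul (QRemainder.const_mul 2 (hT12)) (hE8)) (hE4)) (hE24))) (QRemainder.mul (QRemainder.mul (QRemainder.mul (QRemainder.const_mul 2 (hE8)) (hE12)) (hE4)) (hE24))) (QRemainder.mul (QRemainder.mul (QRemainder.mul (QRemainder.const_mul 2 (hT4)) (hE8)) (hE12)) (hE24))) (QRemainder.mul (QRemainder.mul (QRemainder.mul (QRemainder.const_mul 4 (hT24)) (hE8)) (hE12)) (hE4))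
  have h1 := QRemainder.mul (QRemainder.mul (QRemainder.mul (QRemainder.pow hE8 3) (hE12)) (hE24)) (hinner)
  have h2 := QRemainder.mul (QRemainder.mul (QRemainder.const_mul 2 (QRemainder.pow hE4 5)) (QRemainder.pow hE8 2)) (QRemainder.pow hE12 6)
  have hG := QRemainder.reduce 0
    (32 * X ^ 2 - 4 * X ^ 6 - 108 * X ^ 10 + 24 * X ^ 14 + 140 * X ^ 18 - 46 * X ^ 22 - 94 * X ^ 26 + 34 * X ^ 30 + 40 * X ^ 34
      - 6 * X ^ 38 - 10 * X ^ 42 - 2 * X ^ 46)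
    (by simp only [map_ofNat]; ring) (QRemainder.add h1 h2)
  have hlim := (QRemainder.tendsto_div_pow 8 (by norm_num) hG).mul
    ((((isIntUnitQExp_eulerFn (by norm_num : 0 < 4)).tendsto_one.pow 3).mul ((isIntUnitQExp_eulerFn (by norm_num : 0 < 24)).tendsto_one.pow 6)).inv₀ (by norm_num))
  rw [zero_mul] at hlim
  refine hlim.congr fun τ ↦ ?_
  have hE4' := eulerFn_ne_zero (by norm_num : 0 < 4) τ
  have hE2' := eulerFn_ne_zero (by norm_num : 0 < 2) τ
  have hE6' := eulerFn_ne_zero (by norm_num : 0 < 6) τ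
  have hE8' := eulerFn_ne_zero (by norm_num : 0 < 8) τ
  have hE12' := eulerFn_ne_zero (by norm_num : 0 < 12) τ
  have hE24' := eulerFn_ne_zero (by norm_num : 0 < 24) τ
  have hq := qParam_ne_zero τ
  rw [deriv_x48, y48_eq, phi48_eq]
  field_simp

/-- **(T2)₄₈**: `((2πi)⁻¹y′ + φ₄₈(3x² − 4x − 3))/q⁶ → 0` at `i∞`. [cite: Ligozat1975, Ch. 4] -/
theorem tendsto_T2 :
    Tendsto (fun τ : ℍ ↦ ((2 * π * I)⁻¹ * deriv (etaQuotient 48 (expFn [(2, 1), (4, -2), (6, 1), (8, 3), (12, 2), (24, -5)]) ∘ ofComplex) τ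
      + etaQuotient 48 (expFn [(2, -1), (4, 4), (6, -1), (8, -1), (12, 4), (24, -1)]) τ * (3 * etaQuotient 48 (expFn [(4, -2), (8, 4), (12, 2), (24, -4)]) τ ^ 2
        - 4 * etaQuotient 48 (expFn [(4, -2), (8, 4), (12, 2), (24, -4)]) τ - 3))
      / Function.Periodic.qParam 1 (τ : ℂ) ^ 6) atImInfty (𝓝 0) := by
  have h2pi : (2 * π * I : ℂ) ≠ 0 := by simp [Real.pi_ne_zero, I_ne_zero]
  have hE2 := tendsto_eulerFn_two_nine
  have hE4 := tendsto_eulerFn_four_nine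
  have hE6 := tendsto_eulerFn_six_nine
  have hE8 := tendsto_eulerFn_eight_nine
  have hE12 := tendsto_eulerFn (δ := 12) (m := 9) (by norm_num)
  have hE24 := tendsto_eulerFn (δ := 24) (m := 9) (by norm_num)
  have hT2 := QRemainder.congr_poly (P' := -2 * X ^ 2 - 4 * X ^ 4)
    (by rw [← mul_assoc, ← map_mul, inv_mul_cancel₀ h2pi, map_one, one_mul])
    (QRemainder.const_mul (2 * π * I)⁻¹ tendsto_deriv_eulerFn_two_nine)
  have hT4 := QRemainder.congr_poly (P' := -4 * X ^ 4 - 8 * X ^ 8)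
    (by rw [← mul_assoc, ← map_mul, inv_mul_cancel₀ h2pi, map_one, one_mul])
    (QRemainder.const_mul (2 * π * I)⁻¹ tendsto_deriv_eulerFn_four_nine)
  have hT6 := QRemainder.congr_poly (P' := -6 * X ^ 6)
    (by rw [← mul_assoc, ← map_mul, inv_mul_cancel₀ h2pi, map_one, one_mul])
    (QRemainder.const_mul (2 * π * I)⁻¹ tendsto_deriv_eulerFn_six_nine)
  have hT8 := QRemainder.congr_poly (P' := -8 * X ^ 8)
    (by rw [← mul_assoc, ← map_mul, inv_mul_cancel₀ h2pi, map_one, one_mul])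
    (QRemainder.const_mul (2 * π * I)⁻¹ tendsto_deriv_eulerFn_eight_nine)
  have hT12 := QRemainder.congr_poly (P' := 0) (by rw [mul_zero])
    (QRemainder.const_mul (2 * π * I)⁻¹ (tendsto_deriv_eulerFn (δ := 12) (m := 9) (by norm_num)))
  have hT24 := QRemainder.congr_poly (P' := 0) (by rw [mul_zero])
    (QRemainder.const_mul (2 * π * I)⁻¹ (tendsto_deriv_eulerFn (δ := 24) (m := 9) (by norm_num)))
  -- `G₂ = E₂E₆E₈³E₁₂E₂₄³·inner₂ + 3E₄³E₈⁸E₁₂⁸ − 4q²E₄⁵E₈⁴E₁₂⁶E₂₄⁴ − 3q⁴E₄⁷E₁₂⁴E₂₄⁸ = o(q⁹)`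
  have hinner := QRemainder.sub (QRemainder.sub (QRemainder.sub (QRemainder.add (QRemainder.add (QRemainder.add (QRemainder.mul (QRemainder.mul (QRemainder.mul (QRemainder.mul (QRemainder.mul (hT2) (hE6)) (hE8)) (hE12)) (hE4)) (hE24)) (QRemainder.mul (QRemainder.mul (QRemainder.mul (QRemainder.mul (QRemainder.mul (hT6) (hE2)) (hE8)) (hE12)) (hE4)) (hE24))) (QRemainder.mul (QRemainder.mul (QRemainder.mul (QRemainder.mul (QRemainder.mul (QRemainder.const_mul 3 (hT8)) (hE2)) (hE6)) (hE12)) (hE4)) (hE24))) (QRemainder.mul (QRemainder.mul (QRemainder.mul (QRemainder.mul (QRemainder.mul (QRemainder.const_mul 2 (hT12)) (hE2)) (hE6)) (hE8)) (hE4)) (hE24))) (QRemainder.mul (QRemainder.mul (QRemainder.mul (QRemainder.mul (QRemainder.mul (QRemainder.const_mul 3 (hE2)) (hE6)) (hE8)) (hE12)) (hE4)) (hE24))) (QRemainder.mul (QRemainder.mul (QRemainder.mul (QRemainder.mul (QRemainder.mul (QRemainder.const_mul 2 (hT4)) (hE2)) (hE6)) (hE8)) (hE12)) (hE24))) (QRemainder.mul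 (QRemainder.mul (QRemainder.mul (QRemainder.mul (QRemainder.mul (QRemainder.const_mul 5 (hT24)) (hE2)) (hE6)) (hE8)) (hE12)) (hE4))
  have h1 := QRemainder.mul (QRemainder.mul (QRemainder.mul (QRemainder.mul (QRemainder.mul (hE2) (hE6)) (QRemainder.pow hE8 3)) (hE12)) (QRemainder.pow hE24 3)) (hinner)
  have h2 := QRemainder.mul (QRemainder.mul (QRemainder.const_mul 3 (QRemainder.pow hE4 3)) (QRemainder.pow hE8 8)) (QRemainder.pow hE12 8)
  have h3 := QRemainder.const_mul 4 (QRemainder.qParam_pow_mul 2 (QRemainder.mul (QRemainder.mul (QRemainder.mul (QRemainder.pow hE4 5) (QRemainder.pow hE8 4)) (QRemainder.pow hE12 6)) (QRemainder.pow hE24 4)))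
  have h4 := QRemainder.const_mul 3 (QRemainder.qParam_pow_mul 4 (QRemainder.mul (QRemainder.mul (QRemainder.pow hE4 7) (QRemainder.pow hE12 4)) (QRemainder.pow hE24 8)))
  have hG := QRemainder.reduce 0
    (-4 + 54 * X ^ 2 - 92 * X ^ 4 - 8 * X ^ 6 + 52 * X ^ 8 - 209 * X ^ 10 + 464 * X ^ 12 + 19 * X ^ 14 - 352 * X ^ 16
      + 440 * X ^ 18 - 928 * X ^ 20 + 76 * X ^ 22 + 892 * X ^ 24 - 921 * X ^ 26 + 980 * X ^ 28 - 223 * X ^ 30 - 1040 * X ^ 32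
      + 1514 * X ^ 34 - 652 * X ^ 36 + 254 * X ^ 38 + 588 * X ^ 40 - 1559 * X ^ 42 + 328 * X ^ 44 - 223 * X ^ 46 - 144 * X ^ 48
      + 984 * X ^ 50 - 120 * X ^ 52 + 171 * X ^ 54 + 4 * X ^ 56 - 381 * X ^ 58 + 20 * X ^ 60 - 84 * X ^ 62 + 4 * X ^ 64
      + 87 * X ^ 66 + 24 * X ^ 70 - 9 * X ^ 74 - 3 * X ^ 78)
    (by simp only [map_ofNat]; ring) (QRemainder.sub (QRemainder.sub (QRemainder.add h1 h2) h3) h4)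
  have hlim := (QRemainder.tendsto_div_pow 9 le_rfl hG).mul
    ((((((isIntUnitQExp_eulerFn (by norm_num : 0 < 2)).tendsto_one.pow 1).mul ((isIntUnitQExp_eulerFn (by norm_num : 0 < 6)).tendsto_one.pow 1)).mul ((isIntUnitQExp_eulerFn (by norm_num : 0 < 8)).tendsto_one.pow 1)).mul (((isIntUnitQExp_eulerFn (by norm_num : 0 < 4)).tendsto_one.pow 3).mul ((isIntUnitQExp_eulerFn (by norm_num : 0 < 24)).tendsto_one.pow 9))).inv₀ (by norm_num))
  rw [zero_mul] at hlim
  refine hlim.congr fun τ ↦ ?_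
  have hE2' := eulerFn_ne_zero (by norm_num : 0 < 2) τ
  have hE4' := eulerFn_ne_zero (by norm_num : 0 < 4) τ
  have hE6' := eulerFn_ne_zero (by norm_num : 0 < 6) τ
  have hE8' := eulerFn_ne_zero (by norm_num : 0 < 8) τ
  have hE12' := eulerFn_ne_zero (by norm_num : 0 < 12) τ
  have hE24' := eulerFn_ne_zero (by norm_num : 0 < 24) τ
  have hq := qParam_ne_zero τ
  rw [deriv_y48, x48_eq, phi48_eq]
  field_simp
  ring

/-- **(T3)₄₈**: `x³ − 2x² − 3x − y² → 0` at `i∞`. [cite: Ligozat1975, Ch. 4] -/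
theorem tendsto_T3 :
    Tendsto (fun τ : ℍ ↦ etaQuotient 48 (expFn [(4, -2), (8, 4), (12, 2), (24, -4)]) τ ^ 3
      - 2 * etaQuotient 48 (expFn [(4, -2), (8, 4), (12, 2), (24, -4)]) τ ^ 2
      - 3 * etaQuotient 48 (expFn [(4, -2), (8, 4), (12, 2), (24, -4)]) τ
      - etaQuotient 48 (expFn [(2, 1), (4, -2), (6, 1), (8, 3), (12, 2), (24, -5)]) τ ^ 2) atImInfty (𝓝 0) := by
  have hE2 := tendsto_eulerFn_two_nine
  have hE4 := tendsto_eulerFn_four_nine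
  have hE6 := tendsto_eulerFn_six_nine
  have hE8 := tendsto_eulerFn_eight_nine
  have hE12 := tendsto_eulerFn (δ := 12) (m := 9) (by norm_num)
  have hE24 := tendsto_eulerFn (δ := 24) (m := 9) (by norm_num)
  -- `G₃ = E₈¹²E₁₂⁶ − 2q²E₄²E₈⁸E₁₂⁴E₂₄⁴ − 3q⁴E₄⁴E₈⁴E₁₂²E₂₄⁸ − E₂²E₄²E₆²E₈⁶E₁₂⁴E₂₄² = o(q⁹)`
  have h1 := QRemainder.mul (QRemainder.pow hE8 12) (QRemainder.pow hE12 6)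
  have h2 := QRemainder.const_mul 2 (QRemainder.qParam_pow_mul 2 (QRemainder.mul (QRemainder.mul (QRemainder.mul (QRemainder.pow hE4 2) (QRemainder.pow hE8 8)) (QRemainder.pow hE12 4)) (QRemainder.pow hE24 4)))
  have h3 := QRemainder.const_mul 3 (QRemainder.qParam_pow_mul 4 (QRemainder.mul (QRemainder.mul (QRemainder.mul (QRemainder.pow hE4 4) (QRemainder.pow hE8 4)) (QRemainder.pow hE12 2)) (QRemainder.pow hE24 8)))
  have h4 := QRemainder.mul (QRemainder.mul (QRemainder.mul (QRemainder.mul (QRemainder.mul (QRemainder.pow hE2 2) (QRemainder.pow hE4 2)) (QRemainder.pow hE6 2)) (QRemainder.pow hE8 6)) (QRemainder.pow hE12 4)) (QRemainder.pow hE24 2)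
  have hG := QRemainder.reduce 0
    (2 - 2 * X ^ 2 + 16 * X ^ 6 - 26 * X ^ 8 - 9 * X ^ 10 + 8 * X ^ 12 - 102 * X ^ 14 + 128 * X ^ 16 + 96 * X ^ 18
      - 52 * X ^ 20 + 302 * X ^ 22 - 338 * X ^ 24 - 285 * X ^ 26 + 144 * X ^ 28 - 560 * X ^ 30 + 544 * X ^ 32 + 438 * X ^ 34
      - 220 * X ^ 36 + 727 * X ^ 38 - 562 * X ^ 40 - 396 * X ^ 42 + 200 * X ^ 44 - 682 * X ^ 46 + 376 * X ^ 48 + 216 * X ^ 50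
      - 108 * X ^ 52 + 457 * X ^ 54 - 158 * X ^ 56 - 69 * X ^ 58 + 32 * X ^ 60 - 212 * X ^ 62 + 38 * X ^ 64 + 12 * X ^ 66
      - 4 * X ^ 68 + 65 * X ^ 70 - 4 * X ^ 72 - X ^ 74 - 12 * X ^ 78 + X ^ 86)
    (by simp only [map_ofNat]; ring) (QRemainder.sub (QRemainder.sub (QRemainder.sub h1 h2) h3) h4)
  have hlim := (QRemainder.tendsto_div_pow 6 (by norm_num) hG).mul
    ((((isIntUnitQExp_eulerFn (by norm_num : 0 < 4)).tendsto_one.pow 6).mul ((isIntUnitQExp_eulerFn (by norm_num : 0 < 24)).tendsto_one.pow 12)).inv₀ (by norm_num))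
  rw [zero_mul] at hlim
  refine hlim.congr fun τ ↦ ?_
  have hE4' := eulerFn_ne_zero (by norm_num : 0 < 4) τ
  have hE24' := eulerFn_ne_zero (by norm_num : 0 < 24) τ
  have hq := qParam_ne_zero τ
  rw [x48_eq, y48_eq]
  field_simp

/-! ## §2 The identities and (S2)₄₈ -/

section Phi

variable (φ : CuspForm (Gamma0 48) 2)
  (hφ : ⇑φ = etaQuotient 48 (expFn [(2, -1), (4, 4), (6, -1), (8, -1), (12, 4), (24, -1)]))
include hφ

/-- **(I2a)**: `x′ = −2πi φ₄₈ · 2y` on `ℍ`. [cite: Ligozat1975, Ch. 4] -/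
theorem deriv_x48_identity (τ : ℍ) :
    deriv (etaQuotient 48 (expFn [(4, -2), (8, 4), (12, 2), (24, -4)]) ∘ ofComplex) τ
      = -(2 * π * I * φ τ) * (2 * etaQuotient 48 (expFn [(2, 1), (4, -2), (6, 1), (8, 3), (12, 2), (24, -5)]) τ) := by
  refine deriv_x48_of_tendsto φ hφ ?_ τ
  simpa only [hφ] using tendsto_T1

/-- **(I2b)**: `y′ = −2πi φ₄₈ · (3x² − 4x − 3)` on `ℍ`. [cite: Ligozat1975, Ch. 4] -/
theorem deriv_y48_identity (τ : ℍ) :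
    deriv (etaQuotient 48 (expFn [(2, 1), (4, -2), (6, 1), (8, 3), (12, 2), (24, -5)]) ∘ ofComplex) τ
      = -(2 * π * I * φ τ) * (3 * etaQuotient 48 (expFn [(4, -2), (8, 4), (12, 2), (24, -4)]) τ ^ 2
          - 4 * etaQuotient 48 (expFn [(4, -2), (8, 4), (12, 2), (24, -4)]) τ - 3) := by
  refine deriv_y48_of_tendsto φ hφ ?_ τ
  simpa only [hφ] using tendsto_T2

/-- **(I1): the cubic `y² = x³ − 2x² − 3x` on `ℍ`** — the `η`-quotients parametrise `[0, −2, 0, −3, 0]`, Cremona's `48a1 = [0, 1, 0, −4, −4]`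
translated by `x ↦ x − 1`. [cite: CremonaAlgorithms1997, Table 1 (48a1)] -/
theorem cubic48 (τ : ℍ) :
    etaQuotient 48 (expFn [(4, -2), (8, 4), (12, 2), (24, -4)]) τ ^ 3 - 2 * etaQuotient 48 (expFn [(4, -2), (8, 4), (12, 2), (24, -4)]) τ ^ 2
      - 3 * etaQuotient 48 (expFn [(4, -2), (8, 4), (12, 2), (24, -4)]) τ
      = etaQuotient 48 (expFn [(2, 1), (4, -2), (6, 1), (8, 3), (12, 2), (24, -5)]) τ ^ 2 :=
  cubic48_of_deriv φ (deriv_x48_identity φ hφ) (deriv_y48_identity φ hφ) tendsto_T3 τ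

/-- **(S2)₄₈: `Λ(φ₄₈) ⊆ Λ(52/3, 280/27)`**, the lattice of the Néron invariants `c₄/12, c₆/216` of `48a1`. [cite: CremonaAlgorithms1997, §2.10] -/
theorem periodLatticeLe_fortyEight :
    ∃ L₁ : PeriodPair, L₁.g₂ = 52 / 3 ∧ L₁.g₃ = 280 / 27 ∧ ∀ z ∈ periodLattice φ, z ∈ L₁.lattice :=
  periodLatticeLe48_of_etaIdentities φ hφ (cubic48 φ hφ) (deriv_x48_identity φ hφ)

end Phi

/-! ## §3 The Néron squeeze at level `48`: `|c| = 1` on `X₀(48)` -/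

/-- The literal `ℚ`-model `[0, −2, 0, −3, 0]` read through integer casts. [folklore] -/
theorem mk_fortyEightA1_eq_cast :
    (⟨0, -2, 0, -3, 0⟩ : WeierstrassCurve ℚ) = ⟨((0 : ℤ) : ℚ), ((-2 : ℤ) : ℚ), ((0 : ℤ) : ℚ), ((-3 : ℤ) : ℚ), ((0 : ℤ) : ℚ)⟩ := by
  ext <;> norm_num

/-- `[0, −2, 0, −3, 0] ≅ 48a1` is globally minimal (`Δ = 2⁸3²`, `v₂(Δ) = 8 < 12`, `3 ∤ c₄ = 208`; kernel certificate). [cite: SilvermanAEC2009, VII.1 Remark 1.1] -/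
theorem isGloballyMinimal_fortyEightA1 : (⟨0, -2, 0, -3, 0⟩ : WeierstrassCurve ℚ).IsGloballyMinimal := by
  rw [mk_fortyEightA1_eq_cast]
  exact IntModelCond.isGloballyMinimal_mk_of_minCheck 0 (-2) 0 (-3) 0 (cm := ⟨8, 4, 6, [⟨3, 1, 2, 0, 0⟩]⟩) (by decide +kernel)

/-- `[0, −2, 0, −3, 0]` is an elliptic curve (`Δ = 2304 ≠ 0`); a theorem, use `haveI`. [folklore] -/
theorem isElliptic_fortyEightA1 : (⟨0, -2, 0, -3, 0⟩ : WeierstrassCurve ℚ).IsElliptic :=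
  ⟨by norm_num [WeierstrassCurve.Δ, WeierstrassCurve.b₂, WeierstrassCurve.b₄, WeierstrassCurve.b₆, WeierstrassCurve.b₈]⟩

/-- **The Néron invariants of `[0, −2, 0, −3, 0]`**: `c₄ = 208`, `c₆ = 2240`, so `IsNeronLatticeOf (W₀/ℂ) L ⟺ (g₂(L), g₃(L)) = (52/3, 280/27)`.
[cite: CremonaAlgorithms1997, Table 1 (48a1)] -/
theorem isNeronLatticeOf_fortyEightA1_iff (L : PeriodPair) :
    IsNeronLatticeOf ((⟨0, -2, 0, -3, 0⟩ : WeierstrassCurve ℚ).baseChange ℂ) L ↔ L.g₂ = 52 / 3 ∧ L.g₃ = 280 / 27 := by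
  have h4 : ((⟨0, -2, 0, -3, 0⟩ : WeierstrassCurve ℚ).baseChange ℂ).c₄ = (((⟨0, -2, 0, -3, 0⟩ : WeierstrassCurve ℚ).c₄ : ℚ) : ℂ) := by
    simp [WeierstrassCurve.baseChange, WeierstrassCurve.map_c₄]
  have h6 : ((⟨0, -2, 0, -3, 0⟩ : WeierstrassCurve ℚ).baseChange ℂ).c₆ = (((⟨0, -2, 0, -3, 0⟩ : WeierstrassCurve ℚ).c₆ : ℚ) : ℂ) := by
    simp [WeierstrassCurve.baseChange, WeierstrassCurve.map_c₆]
  have h4' : (⟨0, -2, 0, -3, 0⟩ : WeierstrassCurve ℚ).c₄ = 208 := by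
    norm_num [WeierstrassCurve.c₄, WeierstrassCurve.b₂, WeierstrassCurve.b₄]
  have h6' : (⟨0, -2, 0, -3, 0⟩ : WeierstrassCurve ℚ).c₆ = 2240 := by
    norm_num [WeierstrassCurve.c₆, WeierstrassCurve.b₂, WeierstrassCurve.b₄, WeierstrassCurve.b₆]
  rw [IsNeronLatticeOf, h4, h6, h4', h6']
  push_cast
  constructor
  · rintro ⟨ha, hb⟩; exact ⟨by rw [ha]; norm_num, by rw [hb]; norm_num⟩
  · rintro ⟨ha, hb⟩; exact ⟨by rw [ha]; norm_num, by rw [hb]; norm_num⟩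

/-- **`|c| = 1` for every lattice-optimal `X₀(48)`-datum of every globally minimal elliptic `W/ℚ`** — UNCONDITIONAL (newform pinning
`D.f = φ₄₈` by `NewformFortyEight`, (S2)₄₈ by the `η`-identities, the Néron squeeze with `W₀ ≅ 48a1`).  The first level of the C2
domain with `g(X₀(N)) > 1`. [cite: CremonaAlgorithms1997, §2.10, Table 1 (48a1)] -/
theorem abs_maninConstant_eq_one_fortyEight (W : WeierstrassCurve ℚ) [W.IsElliptic] [W.IsGloballyMinimal]
    (D : ModularParametrizationData W 48)
    (hopt : ∀ z ∈ D.L.lattice, ∃ w ∈ periodLattice D.f, z = D.c * w) :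
    |D.maninConstant| = 1 := by
  haveI := isElliptic_fortyEightA1
  haveI := isGloballyMinimal_fortyEightA1
  obtain ⟨L₁, h2, h3, hle⟩ := periodLatticeLe_fortyEight D.f (f_apply_eq_phi48 D)
  exact NeronSqueeze.abs_maninConstant_eq_one_of_periodLattice_le (⟨0, -2, 0, -3, 0⟩ : WeierstrassCurve ℚ) L₁
    ((isNeronLatticeOf_fortyEightA1_iff L₁).mpr ⟨h2, h3⟩) W D hle hopt

/-- **C2 `ManinOddAtFour` at `N = 48` (`2² ∣ 48`): `2 ∤ c(D)`** for every lattice-optimal `X₀(48)`-datum — UNCONDITIONAL. [folklore] -/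
theorem not_two_dvd_maninConstant_fortyEight (W : WeierstrassCurve ℚ) [W.IsElliptic] [W.IsGloballyMinimal]
    (D : ModularParametrizationData W 48)
    (hopt : ∀ z ∈ D.L.lattice, ∃ w ∈ periodLattice D.f, z = D.c * w) :
    ¬ (2 : ℤ) ∣ D.maninConstant := by
  have h := abs_maninConstant_eq_one_fortyEight W D hopt
  intro h2
  have := Int.le_of_dvd (by rw [h]; norm_num) ((dvd_abs _ _).mpr h2)
  rw [h] at this
  norm_num at this

/-- `2² ∣ 48`: the level `48` lies in C2's `4 ∣ N` world. [folklore] -/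
theorem two_sq_dvd_fortyEight : 2 ^ 2 ∣ 48 := ⟨12, by norm_num⟩

/-- **The C2 conclusion on the whole `X₀(48)`-domain**: `|c| = 1 ∧ 2 ∤ c` for every lattice-optimal `X₀(48)`-datum of every globally
minimal elliptic curve over `ℚ` (and `2² ∣ 48`) — UNCONDITIONAL; BSD and C2 for general `N` are NOT proved by this. [folklore] -/
theorem maninOddAtFour_fortyEight :
    2 ^ 2 ∣ 48 ∧ ∀ (W : WeierstrassCurve ℚ) [W.IsElliptic] [W.IsGloballyMinimal] (D : ModularParametrizationData W 48),
      (∀ z ∈ D.L.lattice, ∃ w ∈ periodLattice D.f, z = D.c * w) → |D.maninConstant| = 1 ∧ ¬ (2 : ℤ) ∣ D.maninConstant :=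
  ⟨two_sq_dvd_fortyEight, fun W _ _ D hopt ↦
    ⟨abs_maninConstant_eq_one_fortyEight W D hopt, not_two_dvd_maninConstant_fortyEight W D hopt⟩⟩

/-! ## §4 `N([0, −2, 0, −3, 0]) = 48` (kernel Tate certificate) and the `X₀(48)`-domain under the item's modularity binder -/

/-- **`N([0, −2, 0, −3, 0]) = 48 = 2⁴·3`**: deep Tate certificate at `2` = change `(r, s, t) = (1, 1, 2)` to `[2, 0, 4, −8, −8]`, exit `I₀*`
(`2 ∣ a₁, a₂`, `4 ∣ a₃, a₄`, `8 ∣ a₆`, the cubic `x³ − 2x − 1` separable mod `2`; `f₂ = v₂(Δ) − 4 = 4`), multiplicative at `3`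
(`3 ∤ c₄ = 208`); all kernel-checked. [cite: Silverman1994, IV.9.4] [cite: CremonaAlgorithms1997, Table 1 (48a1)] -/
theorem conductorNorm_fortyEightA1 : (⟨0, -2, 0, -3, 0⟩ : WeierstrassCurve ℚ).conductorNorm ℤ = 48 := by
  rw [mk_fortyEightA1_eq_cast]
  exact IntModelCond.conductorNorm_mk_eq_of_certs_of_eq 0 (-2) 0 (-3) 0
    (cm := ⟨8, 4, 6, [⟨3, 1, 2, 0, 0⟩]⟩) (c := ⟨8, 4, 6, 2, 0, 0, []⟩)
    (l₂ := ⟨3, 1, 1, 2, 8, 6, 0⟩) (l₃ := ⟨1, 0, 0, 0, 0, 0, 0⟩)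
    (by decide +kernel) (by decide +kernel) (by decide +kernel) (by decide +kernel) (by decide +kernel)

/-- **Modularity at `[0, −2, 0, −3, 0] ≅ 48a1`, levelled**: under `exists_isNewformOf` the curve has a newform in `S₂(Γ₀(48))`
(its conductor IS `48`).  CONDITIONAL on the item's own binder `exists_isNewformOf` (no CM: a fact-free proof is not claimed).
[cite: DiamondShurman2005, Thm. 8.8.3] -/
theorem exists_isNewformOf_fortyEightA1 (hnf : exists_isNewformOf) :
    ∃ f : CuspForm (Gamma0 48) 2, IsNewformOf (⟨0, -2, 0, -3, 0⟩ : WeierstrassCurve ℚ) f := by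
  haveI := isElliptic_fortyEightA1
  have key : ∀ (N : ℕ) [NeZero N], (⟨0, -2, 0, -3, 0⟩ : WeierstrassCurve ℚ).conductorNorm ℤ = N →
      ∃ f : CuspForm (Gamma0 N) 2, IsNewformOf (⟨0, -2, 0, -3, 0⟩ : WeierstrassCurve ℚ) f := by
    intro N _ hN
    subst hN
    exact hnf _
  haveI : NeZero (48 : ℕ) := ⟨by decide⟩
  exact key 48 conductorNorm_fortyEightA1

/-- Under modularity the newform of `48a1` IS `φ₄₈`: `aₙ(η₄⁴η₁₂⁴/(η₂η₆η₈η₂₄)) = aₙ([0, −2, 0, −3, 0])` for all `n` (pinning `NewformFortyEight`).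
CONDITIONAL on `exists_isNewformOf`. [cite: CremonaAlgorithms1997, Table 3 (N = 48)] -/
theorem cuspCoeff_phi48_eq_lFunction_fortyEightA1_of_modularity (hnf : exists_isNewformOf)
    (φ : CuspForm (Gamma0 48) 2) (hφ : ⇑φ = etaQuotient 48 (expFn [(2, -1), (4, 4), (6, -1), (8, -1), (12, 4), (24, -1)])) (n : ℕ) :
    cuspCoeff φ n = ((⟨0, -2, 0, -3, 0⟩ : WeierstrassCurve ℚ).LFunction n : ℂ) := by
  obtain ⟨f, hf⟩ := exists_isNewformOf_fortyEightA1 hnf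
  rw [← eq_phi48_of_isNewform0 φ hφ hf.1]
  exact hf.2 n

/-- **A lattice-optimal `X₀(48)`-datum on a global minimal model in the class `48a` exists under modularity**, i.e. C2's `∀`-domain at
`N = 48` is inhabited relative to the item's hypotheses; CONDITIONAL on `exists_isNewformOf` only. [cite: EdixhovenManin1991, Prop. 2] -/
theorem maninOddAtFour_domain_inhabited_fortyEight_of_modularity (hnf : exists_isNewformOf) :
    ∃ (W₀ : WeierstrassCurve ℚ) (_ : W₀.IsElliptic) (_ : W₀.IsGloballyMinimal) (D₀ : ModularParametrizationData W₀ 48),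
      (⟨0, -2, 0, -3, 0⟩ : WeierstrassCurve ℚ).IsIsogenous W₀ ∧ (∀ z ∈ D₀.L.lattice, ∃ w ∈ periodLattice D₀.f, z = D₀.c * w) ∧
      |D₀.maninConstant| = 1 ∧ 2 ^ 2 ∣ 48 := by
  haveI := isElliptic_fortyEightA1
  haveI : NeZero (48 : ℕ) := ⟨by decide⟩
  obtain ⟨f, hf⟩ := exists_isNewformOf_fortyEightA1 hnf
  obtain ⟨D⟩ := nonempty_modularParametrizationData_of_isNewformOf hf
  obtain ⟨W₀, h₀, hmin, D₀, -, hiso, hopt, -⟩ :=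
    ExistsMinimalOptimalDatum.existsMinimalOptimalDatum_full (⟨0, -2, 0, -3, 0⟩ : WeierstrassCurve ℚ) D
  exact ⟨W₀, h₀, hmin, D₀, hiso, hopt, @abs_maninConstant_eq_one_fortyEight W₀ h₀ hmin D₀ hopt, two_sq_dvd_fortyEight⟩

end Summit.BirchSwinnertonDyer.BirchSwinnertonDyer.Theorems.ManinLocalTwoThree.EtaIdentitiesFortyEight

end
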